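import Mathlib.Analysis.Calculus.FDeriv.Symmetric
import Literature.MathematicalPhysics.QuantumLattice.YangMillsHeatFlow
import Literature.MathematicalPhysics.QuantumLattice.YangMillsClassicalProofs
import HarnessLib

/-!
# Yang–Mills heat flow: assembly lemmas towards `Waldron2019_yangMillsFlow_flatTorus`

Partial, sorry-free progress on the named fact
`Literature.MathematicalPhysics.QuantumLattice.Waldron2019_yangMillsFlow_flatTorus` (Waldron 2019,
Cor. 1.2 with Struwe's short-time existence). The published proof has the architecture
(S1) short-time existence of classical solutions (Struwe 1994 §4, DeTurck gauge) — (S2) the global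
energy identity `½ d/dt ∫|F|² + ∫|D^*F|² = 0` (Waldron 2019 §2, (2.5) with `χ ≡ 1` on a closed
manifold), giving hypothesis (1.1) of Waldron's Thm. 1.1 — (S3) Waldron's Thm. 1.1 (no finite-time
energy concentration, `C^∞_loc` limit at `T`) — (S4) continuation past every finite `T` (Cor. 1.2) —
(S5) assembly: the jointly smooth global solution on the flat torus, read as an `L`-periodic
solution on `ℝ⁴`, is an immortal flow line in the sense of `IsYangMillsHeatFlow`.

This file formalizes the assembly step (S5): for a time-dependent connection that is jointly smooth
on positive space-time, the record `IsYangMillsHeatFlow 𝔤 A` (slice smoothness, `𝔤`-values,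
classical time derivative, continuity of the right-hand side in time) reduces to the pointwise
partial differential equation `∂ₜ A_v(t,x) = Σ_μ D_μ F_{μ v}(t,x)` (`IsYangMillsHeatFlow.of_contDiffOn`),
and consequently the named fact follows from the classical PDE formulation of global existence
(`Waldron2019_yangMillsFlow_flatTorus_of_pde`), and from its two published analytic ingredients
taken as hypotheses — Struwe's short-time existence and Waldron's Cor. 1.2 "classical solutions
extend smoothly for all time" (`Waldron2019_yangMillsFlow_flatTorus_of_shortTime_of_extends`).
Towards the energy identity (S2) it also proves
the first pointwise ingredient of Waldron's §2: for a jointly `C²` time-dependent connection the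
mixed partials commute (`hasDerivAt_fderiv_slice`) and the curvature evolves by
`∂ₜ F_{u w} = D_u Ȧ_w − D_w Ȧ_u` (`hasDerivAt_curvature_slice`; under (YM) this is
`(∂ₜ + D D^*) F = 0`), and the frame independence of the covariant divergence
`div_A F_A = Σᵢ D_{bᵢ} F(bᵢ, ·)` (`divCurvature_eq_sum_orthonormalBasis`, so that the flow equation
may be written in lattice coordinates on the torus), the joint regularity of the curvature
(`contDiffOn_curvature_joint`, `contDiff_curvature_apply`) and the transfer of lattice periodicity
to derivatives and curvature (`fderiv_joint_comp_add`, `curvature_comp_add`). The energy identity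
itself (matrix coefficients, flat torus) is in `YangMillsHeatFlowEnergy.lean`. Steps (S1), (S3),
(S4) (parabolic existence theory and Waldron's estimates) are not available over Mathlib at
present.

References: A. Waldron, *Long-time existence for Yang–Mills flow*, Invent. Math. 217 (2019),
§1 (YM), Thm. 1.1, Cor. 1.2 [Waldron2019]; M. Struwe, *The Yang–Mills flow in four dimensions*,
Calc. Var. 2 (1994), §4 [Struwe1994].
-/

noncomputable section

open scoped ContDiff Topology RealInnerProductSpace
open Set Filter

namespace Literature.MathematicalPhysics.QuantumLattice

section Slices

variable {E : Type*} [NormedAddCommGroup E] [InnerProductSpace ℝ E]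
variable {𝔸 : Type*} [NormedRing 𝔸] [NormedAlgebra ℝ 𝔸]

/-- A time slice `x ↦ A t x`, `t > 0`, of a map jointly `C^n` on positive space-time
`(0, ∞) × E` is `C^n`. [folklore] -/
theorem contDiff_slice_of_contDiffOn {n : WithTop ℕ∞} {A : ℝ → Connection E 𝔸}
    (hA : ContDiffOn ℝ n (fun p : ℝ × E => A p.1 p.2) (Ioi (0 : ℝ) ×ˢ (univ : Set E)))
    {t : ℝ} (ht : 0 < t) : ContDiff ℝ n (A t) := by
  have : A t = (fun p : ℝ × E => A p.1 p.2) ∘ fun x : E => (t, x) := rfl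
  rw [this]
  exact hA.comp_contDiff (contDiff_const.prodMk contDiff_id) fun x => ⟨ht, mem_univ x⟩

/-- For a map jointly `C^n`, `n ≠ 0`, on positive space-time, the partial time derivative of
`s ↦ A s x v` at `t > 0` exists and is the joint Fréchet derivative applied to `(1, 0)` and `v`.
[folklore] -/
theorem hasDerivAt_slice_of_contDiffOn {n : WithTop ℕ∞} {A : ℝ → Connection E 𝔸}
    (hA : ContDiffOn ℝ n (fun p : ℝ × E => A p.1 p.2) (Ioi (0 : ℝ) ×ˢ (univ : Set E)))
    (hn : n ≠ 0) {t : ℝ} (ht : 0 < t) (x v : E) :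
    HasDerivAt (fun s => A s x v)
      (fderiv ℝ (fun p : ℝ × E => A p.1 p.2) (t, x) ((1 : ℝ), (0 : E)) v) t := by
  have hmem : Ioi (0 : ℝ) ×ˢ (univ : Set E) ∈ 𝓝 (t, x) :=
    (isOpen_Ioi.prod isOpen_univ).mem_nhds ⟨ht, mem_univ x⟩
  have hdiff : DifferentiableAt ℝ (fun p : ℝ × E => A p.1 p.2) (t, x) :=
    (hA.differentiableOn hn).differentiableAt hmem
  have hcurve : HasDerivAt (fun s : ℝ => (s, x)) ((1 : ℝ), (0 : E)) t :=
    (hasDerivAt_id t).prodMk (hasDerivAt_const t x)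
  have hcomp : HasDerivAt (fun s : ℝ => A s x)
      (fderiv ℝ (fun p : ℝ × E => A p.1 p.2) (t, x) ((1 : ℝ), (0 : E))) t := by
    have h := hdiff.hasFDerivAt.comp_hasDerivAt t hcurve
    simpa [Function.comp_def] using h
  simpa using hcomp.clm_apply (hasDerivAt_const t v)

/-- For a map jointly `C^n`, `n ≠ 0`, on positive space-time, `deriv (s ↦ A s x v) t` at `t > 0`
is the joint Fréchet derivative applied to `(1, 0)` and `v`. [folklore] -/
theorem deriv_slice_of_contDiffOn {n : WithTop ℕ∞} {A : ℝ → Connection E 𝔸}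
    (hA : ContDiffOn ℝ n (fun p : ℝ × E => A p.1 p.2) (Ioi (0 : ℝ) ×ˢ (univ : Set E)))
    (hn : n ≠ 0) {t : ℝ} (ht : 0 < t) (x v : E) :
    deriv (fun s => A s x v) t =
      fderiv ℝ (fun p : ℝ × E => A p.1 p.2) (t, x) ((1 : ℝ), (0 : E)) v :=
  (hasDerivAt_slice_of_contDiffOn hA hn ht x v).deriv

/-- For a map jointly `C^n`, `n ≠ 0`, on positive space-time, the partial time derivative
`t ↦ ∂ₜ A_v(t, x)` is continuous on `(0, ∞)`. [folklore] -/
theorem continuousOn_deriv_slice_of_contDiffOn {n : WithTop ℕ∞} {A : ℝ → Connection E 𝔸}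
    (hA : ContDiffOn ℝ n (fun p : ℝ × E => A p.1 p.2) (Ioi (0 : ℝ) ×ˢ (univ : Set E)))
    (hn : n ≠ 0) (x v : E) :
    ContinuousOn (fun t => deriv (fun s => A s x v) t) (Ioi 0) := by
  have hF : ContinuousOn (fun p : ℝ × E => fderiv ℝ (fun q : ℝ × E => A q.1 q.2) p)
      (Ioi (0 : ℝ) ×ˢ (univ : Set E)) :=
    hA.continuousOn_fderiv_of_isOpen (isOpen_Ioi.prod isOpen_univ)
      (ENat.one_le_iff_ne_zero_withTop.mpr hn)
  have hG : ContinuousOn (fun t : ℝ => fderiv ℝ (fun q : ℝ × E => A q.1 q.2) (t, x)) (Ioi 0) :=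
    hF.comp (continuousOn_id.prodMk continuousOn_const) fun t ht => ⟨ht, mem_univ x⟩
  have hH : ContinuousOn
      (fun t : ℝ => fderiv ℝ (fun q : ℝ × E => A q.1 q.2) (t, x) ((1 : ℝ), (0 : E)) v) (Ioi 0) :=
    ((ContinuousLinearMap.apply ℝ 𝔸 v).continuous.comp
      (ContinuousLinearMap.apply ℝ (E →L[ℝ] 𝔸) ((1 : ℝ), (0 : E))).continuous).comp_continuousOn hG
  refine hH.congr fun t ht => ?_
  exact deriv_slice_of_contDiffOn hA hn ht x v

end Slices

section Assembly

variable {E : Type*} [NormedAddCommGroup E] [InnerProductSpace ℝ E] [FiniteDimensional ℝ E]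
variable {𝔸 : Type*} [NormedRing 𝔸] [NormedAlgebra ℝ 𝔸]

/-- **Assembly step (S5).** A time-dependent connection which is jointly smooth on positive
space-time `(0, ∞) × E`, `𝔤`-valued at positive times, and satisfies the Yang–Mills heat equation
`∂ₜ A_v(t, x) = Σ_μ D_μ F_{μ v}(t, x) = −(D_A^* F_A)_v` pointwise for `t > 0`, is an immortal flow
line in the sense of `IsYangMillsHeatFlow`: slice smoothness, the classical time derivative and the
continuity of `t ↦ −D_A^* F_A` all follow from joint smoothness. Waldron (2019) §1, (YM)
(classical solutions). [cite: Waldron2019, §1 eq. (YM)] -/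
theorem IsYangMillsHeatFlow.of_contDiffOn {𝔤 : Submodule ℝ 𝔸} {A : ℝ → Connection E 𝔸}
    (hA : ContDiffOn ℝ ∞ (fun p : ℝ × E => A p.1 p.2) (Ioi (0 : ℝ) ×ˢ (univ : Set E)))
    (hv : ∀ ⦃t : ℝ⦄, 0 < t → (A t).IsValuedIn 𝔤)
    (hpde : ∀ ⦃t : ℝ⦄, 0 < t → ∀ x v : E, deriv (fun s => A s x v) t = divCurvature (A t) x v) :
    IsYangMillsHeatFlow 𝔤 A where
  smooth _ ht := contDiff_slice_of_contDiffOn hA ht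
  isValuedIn := hv
  hasDerivAt t ht x v := by
    rw [← hpde ht x v, deriv_slice_of_contDiffOn hA (by simp) ht x v]
    exact hasDerivAt_slice_of_contDiffOn hA (by simp) ht x v
  continuousOn_deriv x v :=
    (continuousOn_deriv_slice_of_contDiffOn hA (by simp) x v).congr fun _ ht => (hpde ht x v).symm

/-- Conversely, along a flow line the partial time derivative is the flow vector field:
`∂ₜ A_v(t,x) = Σ_μ D_μ F_{μ v}(t, x)` for `t > 0`. [folklore] -/
theorem IsYangMillsHeatFlow.deriv_eq {𝔤 : Submodule ℝ 𝔸} {A : ℝ → Connection E 𝔸}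
    (h : IsYangMillsHeatFlow 𝔤 A) {t : ℝ} (ht : 0 < t) (x v : E) :
    deriv (fun s => A s x v) t = divCurvature (A t) x v :=
  (h.hasDerivAt ht x v).deriv

/-- For jointly smooth, `𝔤`-valued time-dependent connections, being a flow line is *equivalent*
to the pointwise Yang–Mills heat equation on `(0, ∞)`. [folklore] -/
theorem isYangMillsHeatFlow_iff_of_contDiffOn {𝔤 : Submodule ℝ 𝔸} {A : ℝ → Connection E 𝔸}
    (hA : ContDiffOn ℝ ∞ (fun p : ℝ × E => A p.1 p.2) (Ioi (0 : ℝ) ×ˢ (univ : Set E)))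
    (hv : ∀ ⦃t : ℝ⦄, 0 < t → (A t).IsValuedIn 𝔤) :
    IsYangMillsHeatFlow 𝔤 A ↔
      ∀ ⦃t : ℝ⦄, 0 < t → ∀ x v : E, deriv (fun s => A s x v) t = divCurvature (A t) x v :=
  ⟨fun h _ ht x v => h.deriv_eq ht x v, fun h => IsYangMillsHeatFlow.of_contDiffOn hA hv h⟩

end Assembly

/-! ### Evolution of the curvature (Waldron 2019 §2): `∂ₜ F = D_A Ȧ` -/

section TimeDerivative

variable {E : Type*} [NormedAddCommGroup E] [InnerProductSpace ℝ E]
variable {𝔸 : Type*} [NormedRing 𝔸] [NormedAlgebra ℝ 𝔸]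

/-- The joint map of a time-dependent connection that is `C^n`, `n ≠ 0`, on an open set is
Fréchet differentiable there. [folklore] -/
theorem hasFDerivAt_joint {n : WithTop ℕ∞} {A : ℝ → Connection E 𝔸} {U : Set (ℝ × E)}
    (hU : IsOpen U) (hA : ContDiffOn ℝ n (fun p : ℝ × E => A p.1 p.2) U) (hn : n ≠ 0)
    {p : ℝ × E} (hp : p ∈ U) :
    HasFDerivAt (fun p : ℝ × E => A p.1 p.2) (fderiv ℝ (fun p : ℝ × E => A p.1 p.2) p) p :=
  ((hA.differentiableOn hn).differentiableAt (hU.mem_nhds hp)).hasFDerivAt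

/-- Spatial derivatives of a slice are partial derivatives of the joint map:
`∂_u A_w(t, ·)(x) = DĀ(t,x)[(0,u)] w`. [folklore] -/
theorem fderiv_slice_apply {n : WithTop ℕ∞} {A : ℝ → Connection E 𝔸} {U : Set (ℝ × E)}
    (hU : IsOpen U) (hA : ContDiffOn ℝ n (fun p : ℝ × E => A p.1 p.2) U) (hn : n ≠ 0)
    {t : ℝ} {x : E} (hp : (t, x) ∈ U) (u w : E) :
    fderiv ℝ (fun y => A t y w) x u =
      fderiv ℝ (fun p : ℝ × E => A p.1 p.2) (t, x) ((0 : ℝ), u) w := by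
  have hj := hasFDerivAt_joint hU hA hn hp
  have hemb : HasFDerivAt (fun y : E => ((t, y) : ℝ × E))
      ((0 : E →L[ℝ] ℝ).prod (ContinuousLinearMap.id ℝ E)) x :=
    (hasFDerivAt_const t x).prodMk (hasFDerivAt_id x)
  have hslice : HasFDerivAt (fun y : E => A t y)
      ((fderiv ℝ (fun p : ℝ × E => A p.1 p.2) (t, x)).comp
        ((0 : E →L[ℝ] ℝ).prod (ContinuousLinearMap.id ℝ E))) x := by
    have h := hj.comp x hemb
    simpa [Function.comp_def] using h
  have happ : HasFDerivAt (fun y : E => A t y w)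
      (((fderiv ℝ (fun p : ℝ × E => A p.1 p.2) (t, x)).comp
        ((0 : E →L[ℝ] ℝ).prod (ContinuousLinearMap.id ℝ E))).flip w) x := by
    simpa using hslice.clm_apply (hasFDerivAt_const w x)
  rw [happ.fderiv]
  simp

/-- Time derivatives of a slice component are partial derivatives of the joint map:
`∂ₜ A_w(·, x)(t) = DĀ(t,x)[(1,0)] w`. [folklore] -/
theorem hasDerivAt_slice_apply {n : WithTop ℕ∞} {A : ℝ → Connection E 𝔸} {U : Set (ℝ × E)}
    (hU : IsOpen U) (hA : ContDiffOn ℝ n (fun p : ℝ × E => A p.1 p.2) U) (hn : n ≠ 0)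
    {t : ℝ} {x : E} (hp : (t, x) ∈ U) (w : E) :
    HasDerivAt (fun s => A s x w)
      (fderiv ℝ (fun p : ℝ × E => A p.1 p.2) (t, x) ((1 : ℝ), (0 : E)) w) t := by
  have hj := hasFDerivAt_joint hU hA hn hp
  have hcurve : HasDerivAt (fun s : ℝ => ((s, x) : ℝ × E)) ((1 : ℝ), (0 : E)) t :=
    (hasDerivAt_id t).prodMk (hasDerivAt_const t x)
  have hcomp : HasDerivAt (fun s : ℝ => A s x)
      (fderiv ℝ (fun p : ℝ × E => A p.1 p.2) (t, x) ((1 : ℝ), (0 : E))) t := by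
    have h := hj.comp_hasDerivAt t hcurve
    simpa [Function.comp_def] using h
  simpa using hcomp.clm_apply (hasDerivAt_const t w)

/-- Spatial derivative of the time derivative: for a map jointly `C^n`, `2 ≤ n`, on an open set
`U ∋ (t, x)`, the slice `y ↦ ∂ₜ A_w(t, y) = DĀ(t,y)[(1,0)] w` has Fréchet derivative
`u ↦ D²Ā(t,x)[(0,u)][(1,0)] w` at `x`. [folklore] -/
theorem hasFDerivAt_timeDeriv_slice {n : WithTop ℕ∞} {A : ℝ → Connection E 𝔸} {U : Set (ℝ × E)}
    (hU : IsOpen U) (hA : ContDiffOn ℝ n (fun p : ℝ × E => A p.1 p.2) U) (hn : 2 ≤ n)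
    {t : ℝ} {x : E} (hp : (t, x) ∈ U) (w : E) :
    HasFDerivAt (fun y => fderiv ℝ (fun p : ℝ × E => A p.1 p.2) (t, y) ((1 : ℝ), (0 : E)) w)
      ((((fderiv ℝ (fderiv ℝ (fun p : ℝ × E => A p.1 p.2)) (t, x)).comp
        ((0 : E →L[ℝ] ℝ).prod (ContinuousLinearMap.id ℝ E))).flip ((1 : ℝ), (0 : E))).flip w)
      x := by
  set Ā : ℝ × E → E →L[ℝ] 𝔸 := fun p => A p.1 p.2 with hĀ
  have hn1 : (1 : WithTop ℕ∞) ≤ n := le_trans (by exact_mod_cast (by norm_num : (1:ℕ) ≤ 2)) hn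
  have hA' : ContDiffOn ℝ (n - 1) (fderiv ℝ Ā) U :=
    hA.fderiv_of_isOpen hU (m := n - 1) (by simpa using (tsub_add_cancel_of_le hn1).le)
  have hn1' : n - 1 ≠ 0 := by
    intro h
    have : n ≤ 1 := tsub_eq_zero_iff_le.mp h
    exact absurd (le_trans hn this) (by exact_mod_cast (by norm_num : ¬ ((2:ℕ) ≤ 1)))
  have hd' : HasFDerivAt (fderiv ℝ Ā) (fderiv ℝ (fderiv ℝ Ā) (t, x)) (t, x) :=
    ((hA'.differentiableOn hn1').differentiableAt (hU.mem_nhds hp)).hasFDerivAt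
  have hemb : HasFDerivAt (fun y : E => ((t, y) : ℝ × E))
      ((0 : E →L[ℝ] ℝ).prod (ContinuousLinearMap.id ℝ E)) x :=
    (hasFDerivAt_const t x).prodMk (hasFDerivAt_id x)
  have h3 : HasFDerivAt (fun y : E => fderiv ℝ Ā (t, y))
      ((fderiv ℝ (fderiv ℝ Ā) (t, x)).comp ((0 : E →L[ℝ] ℝ).prod (ContinuousLinearMap.id ℝ E)))
      x := by
    have h := HasFDerivAt.comp (g := fderiv ℝ Ā) (f := fun y : E => ((t, y) : ℝ × E)) x hd' hemb
    simpa [Function.comp_def] using h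
  have h := (h3.clm_apply (hasFDerivAt_const ((1 : ℝ), (0 : E)) x)).clm_apply
    (hasFDerivAt_const w x)
  simpa using h

/-- In particular `∂_u (∂ₜ A_w)(t, ·)(x) = D²Ā(t,x)[(0,u)][(1,0)] w`. [folklore] -/
theorem fderiv_timeDeriv_slice {n : WithTop ℕ∞} {A : ℝ → Connection E 𝔸} {U : Set (ℝ × E)}
    (hU : IsOpen U) (hA : ContDiffOn ℝ n (fun p : ℝ × E => A p.1 p.2) U) (hn : 2 ≤ n)
    {t : ℝ} {x : E} (hp : (t, x) ∈ U) (u w : E) :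
    fderiv ℝ (fun y => fderiv ℝ (fun p : ℝ × E => A p.1 p.2) (t, y) ((1 : ℝ), (0 : E)) w) x u =
      fderiv ℝ (fderiv ℝ (fun p : ℝ × E => A p.1 p.2)) (t, x) ((0 : ℝ), u) ((1 : ℝ), (0 : E)) w := by
  rw [(hasFDerivAt_timeDeriv_slice hU hA hn hp w).fderiv]
  simp

/-- **Mixed partials commute** for a jointly `C²` time-dependent connection: the time derivative
of the spatial derivative `s ↦ ∂_u A_w(s, ·)(x)` at `t` is the spatial derivative of the time
derivative, `∂_u (∂ₜ A_w)(t, ·)(x)`. [folklore] -/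
theorem hasDerivAt_fderiv_slice {n : WithTop ℕ∞} {A : ℝ → Connection E 𝔸} {U : Set (ℝ × E)}
    (hU : IsOpen U) (hA : ContDiffOn ℝ n (fun p : ℝ × E => A p.1 p.2) U) (hn : 2 ≤ n)
    {t : ℝ} {x : E} (hp : (t, x) ∈ U) (u w : E) :
    HasDerivAt (fun s => fderiv ℝ (fun y => A s y w) x u)
      (fderiv ℝ (fun y => fderiv ℝ (fun p : ℝ × E => A p.1 p.2) (t, y) ((1 : ℝ), (0 : E)) w) x u)
      t := by
  set Ā : ℝ × E → E →L[ℝ] 𝔸 := fun p => A p.1 p.2 with hĀ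
  have hn0 : n ≠ 0 := by
    rintro rfl
    exact (not_le.mpr (by exact_mod_cast (by norm_num : (0:ℕ) < 2) : (0 : WithTop ℕ∞) < 2)) hn
  have hn1 : (1 : WithTop ℕ∞) ≤ n := le_trans (by exact_mod_cast (by norm_num : (1:ℕ) ≤ 2)) hn
  -- `Ā` is `C^n` at every point of `U`, its derivative `Ā'` is `C^{n-1}` there
  have hcontAt : ∀ q ∈ U, ContDiffAt ℝ n Ā q := fun q hq => hA.contDiffAt (hU.mem_nhds hq)
  have hd : ∀ q ∈ U, HasFDerivAt Ā (fderiv ℝ Ā q) q := fun q hq =>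
    hasFDerivAt_joint hU hA hn0 hq
  have hA' : ContDiffOn ℝ (n - 1) (fderiv ℝ Ā) U := by
    have := hA.fderiv_of_isOpen hU (m := n - 1) (by
      simpa using (tsub_add_cancel_of_le hn1).le)
    exact this
  have hn1' : n - 1 ≠ 0 := by
    intro h
    have : n ≤ 1 := tsub_eq_zero_iff_le.mp h
    exact absurd (le_trans hn this) (by exact_mod_cast (by norm_num : ¬ ((2:ℕ) ≤ 1)))
  have hd' : HasFDerivAt (fderiv ℝ Ā) (fderiv ℝ (fderiv ℝ Ā) (t, x)) (t, x) :=
    ((hA'.differentiableOn hn1').differentiableAt (hU.mem_nhds hp)).hasFDerivAt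
  -- symmetry of the second derivative at `(t, x)`
  have hsymm : IsSymmSndFDerivAt ℝ Ā (t, x) :=
    (hcontAt _ hp).isSymmSndFDerivAt (by simpa using hn)
  -- LHS function, rewritten through the joint derivative on a neighbourhood of `t`
  have hev : ∀ᶠ s in 𝓝 t, fderiv ℝ (fun y => A s y w) x u = fderiv ℝ Ā (s, x) ((0 : ℝ), u) w := by
    have hsec : ∀ᶠ s in 𝓝 t, (s, x) ∈ U := by
      have : Continuous fun s : ℝ => ((s, x) : ℝ × E) := continuous_id.prodMk continuous_const
      exact this.continuousAt.preimage_mem_nhds (hU.mem_nhds hp)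
    filter_upwards [hsec] with s hs
    exact fderiv_slice_apply hU hA hn0 hs u w
  -- derivative of `s ↦ Ā'(s,x)[(0,u)] w` in `s`
  have hcurve : HasDerivAt (fun s : ℝ => ((s, x) : ℝ × E)) ((1 : ℝ), (0 : E)) t :=
    (hasDerivAt_id t).prodMk (hasDerivAt_const t x)
  have h1 : HasDerivAt (fun s : ℝ => fderiv ℝ Ā (s, x))
      (fderiv ℝ (fderiv ℝ Ā) (t, x) ((1 : ℝ), (0 : E))) t := by
    have h := HasFDerivAt.comp_hasDerivAt (l := fderiv ℝ Ā) (f := fun s : ℝ => ((s, x) : ℝ × E))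
      t hd' hcurve
    simpa [Function.comp_def] using h
  have h2 : HasDerivAt (fun s : ℝ => fderiv ℝ Ā (s, x) ((0 : ℝ), u) w)
      (fderiv ℝ (fderiv ℝ Ā) (t, x) ((1 : ℝ), (0 : E)) ((0 : ℝ), u) w) t := by
    have h := (h1.clm_apply (hasDerivAt_const t ((0 : ℝ), u))).clm_apply (hasDerivAt_const t w)
    simpa using h
  -- RHS: spatial derivative of `y ↦ Ā'(t,y)[(1,0)] w` at `x`
  have hR := fderiv_timeDeriv_slice hU hA hn hp u w
  rw [show (fun y => fderiv ℝ (fun p : ℝ × E => A p.1 p.2) (t, y) ((1 : ℝ), (0 : E)) w) =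
      fun y => fderiv ℝ Ā (t, y) ((1 : ℝ), (0 : E)) w from rfl, hR, ← hsymm.eq]
  exact h2.congr_of_eventuallyEq hev

/-- **Evolution of the curvature** of a jointly `C²` time-dependent connection:
`∂ₜ F_{u w}(t, x) = D_u Ȧ_w − D_w Ȧ_u`, where `Ȧ(t, y)(w) = ∂ₜ A_w(t, y)` is the time derivative,
read off the joint Fréchet derivative. Under (YM), `Ȧ = −D_A^* F_A` and this is Waldron's
`(∂ₜ + D D^*) F = 0`. Waldron (2019) §2, display before (2.4). [cite: Waldron2019, §2] -/
theorem hasDerivAt_curvature_slice {n : WithTop ℕ∞} {A : ℝ → Connection E 𝔸} {U : Set (ℝ × E)}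
    (hU : IsOpen U) (hA : ContDiffOn ℝ n (fun p : ℝ × E => A p.1 p.2) U) (hn : 2 ≤ n)
    {t : ℝ} {x : E} (hp : (t, x) ∈ U) (u w : E) :
    HasDerivAt (fun s => curvature (A s) x u w)
      (covDeriv (A t)
          (fun y => fderiv ℝ (fun p : ℝ × E => A p.1 p.2) (t, y) ((1 : ℝ), (0 : E)) w) x u -
        covDeriv (A t)
          (fun y => fderiv ℝ (fun p : ℝ × E => A p.1 p.2) (t, y) ((1 : ℝ), (0 : E)) u) x w) t := by
  have hn0 : n ≠ 0 := by
    rintro rfl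
    exact (not_le.mpr (by exact_mod_cast (by norm_num : (0:ℕ) < 2) : (0 : WithTop ℕ∞) < 2)) hn
  -- the four pieces of `F = ∂_u A_w - ∂_w A_u + A_u A_w - A_w A_u`
  have h1 := hasDerivAt_fderiv_slice hU hA hn hp u w
  have h2 := hasDerivAt_fderiv_slice hU hA hn hp w u
  have hu := hasDerivAt_slice_apply hU hA hn0 hp u
  have hw := hasDerivAt_slice_apply hU hA hn0 hp w
  have hF : (fun s => curvature (A s) x u w) = fun s =>
      fderiv ℝ (fun y => A s y w) x u - fderiv ℝ (fun y => A s y u) x w +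
        (A s x u * A s x w - A s x w * A s x u) := by
    funext s
    simp only [curvature, Ring.lie_def]
  rw [hF]
  have h := (h1.sub h2).add ((hu.mul hw).sub (hw.mul hu))
  refine h.congr_deriv ?_
  simp only [covDeriv, Ring.lie_def]
  noncomm_ring

end TimeDerivative

/-! ### Frame independence of the covariant divergence -/

section FrameIndependence

variable {E : Type*} [NormedAddCommGroup E] [InnerProductSpace ℝ E]

/-- The contraction `∑ᵢ B(bᵢ, bᵢ)` of a bilinear map over an orthonormal basis (its trace) does
not depend on the orthonormal basis. [folklore] -/
theorem sum_apply_self_eq_of_orthonormalBasis {ι ι' F : Type*} [Fintype ι] [Fintype ι']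
    [AddCommGroup F] [Module ℝ F] (b : OrthonormalBasis ι ℝ E) (c : OrthonormalBasis ι' ℝ E)
    (B : E →ₗ[ℝ] E →ₗ[ℝ] F) : ∑ i, B (b i) (b i) = ∑ j, B (c j) (c j) := by
  classical
  -- expand `b i` in the basis `c`
  have hexp : ∀ i, B (b i) (b i) = ∑ j, ∑ k, (⟪c j, b i⟫ * ⟪c k, b i⟫) • B (c j) (c k) := by
    intro i
    conv_lhs => rw [← c.sum_repr' (b i)]
    simp only [map_sum, map_smul, LinearMap.sum_apply, LinearMap.smul_apply, Finset.smul_sum,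
      smul_smul]
    rw [Finset.sum_comm]
    exact Finset.sum_congr rfl fun j _ => Finset.sum_congr rfl fun k _ => by rw [mul_comm]
  simp_rw [hexp]
  rw [Finset.sum_comm]
  refine Finset.sum_congr rfl fun j _ => ?_
  rw [Finset.sum_comm]
  have hδ : ∀ k, ∑ i, ⟪c j, b i⟫ * ⟪c k, b i⟫ = if j = k then 1 else 0 := by
    intro k
    simp_rw [fun i => real_inner_comm (b i) (c k)]
    rw [b.sum_inner_mul_inner, c.inner_eq_ite]
  simp_rw [← Finset.sum_smul, hδ, ite_smul, one_smul, zero_smul, Finset.sum_ite_eq,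
    Finset.mem_univ, if_true]

variable {𝔸 : Type*} [NormedRing 𝔸] [NormedAlgebra ℝ 𝔸]

/-- For a `C²` connection, `(u, w) ↦ D_u (F_A(·)(w, v))(x)` is bilinear (the second derivatives,
first derivatives and values of `A` enter linearly). [folklore] -/
theorem exists_bilin_eq_covDeriv_curvature (A : Connection E 𝔸) (hA : ContDiff ℝ 2 A)
    (x v : E) : ∃ B : E →ₗ[ℝ] E →ₗ[ℝ] 𝔸,
      ∀ u w, B u w = covDeriv A (fun y => curvature A y w v) x u := by
  set A' : E → E →L[ℝ] E →L[ℝ] 𝔸 := fderiv ℝ A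
  set A'' : E →L[ℝ] E →L[ℝ] E →L[ℝ] 𝔸 := fderiv ℝ (fderiv ℝ A) x
  have hd : ∀ y, HasFDerivAt A (A' y) y := fun y =>
    (hA.differentiable two_ne_zero y).hasFDerivAt
  have hd' : HasFDerivAt A' A'' x :=
    ((hA.fderiv_right (m := 1) le_rfl).differentiable one_ne_zero x).hasFDerivAt
  have hc : ∀ y b, HasFDerivAt (fun z => A z b) ((A' y).flip b) y := fun y b => by
    simpa using (hd y).clm_apply (hasFDerivAt_const b y)
  have h1 : ∀ a b y, fderiv ℝ (fun z => A z b) y a = A' y a b := by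
    intro a b y
    rw [(hc y b).fderiv, ContinuousLinearMap.flip_apply]
  -- the curvature as a function of the base point
  have hF : ∀ a b, (fun y => curvature A y a b) =
      fun y => A' y a b - A' y b a + (A y a * A y b - A y b * A y a) := by
    intro a b
    funext y
    simp only [curvature, Ring.lie_def, h1]
  have h2 : ∀ a b, HasFDerivAt (fun y => A' y a b) ((A''.flip a).flip b) x := fun a b => by
    simpa using ((hd'.clm_apply (hasFDerivAt_const a x)).clm_apply (hasFDerivAt_const b x))
  have hF' : ∀ a b c, fderiv ℝ (fun y => curvature A y a b) x c =
      A'' c a b - A'' c b a +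
        (A x a * A' x c b + A' x c a * A x b - (A x b * A' x c a + A' x c b * A x a)) := by
    intro a b c
    rw [hF, (((h2 a b).fun_sub (h2 b a)).fun_add
      (((hc x a).fun_mul' (hc x b)).fun_sub ((hc x b).fun_mul' (hc x a)))).fderiv]
    simp only [add_apply, sub_apply, ContinuousLinearMap.flip_apply, smul_apply, smul_eq_mul,
      op_smul_eq_mul]
  -- the derivative part `∂_u (F(·)(w, v))(x)` as an explicit bilinear expression
  set G : E → E → 𝔸 := fun u w =>
    A'' u w v - A'' u v w +
      (A x w * A' x u v + A' x u w * A x v - (A x v * A' x u w + A' x u v * A x w)) with hG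
  have hB₁ : ∃ B₁ : E →ₗ[ℝ] E →ₗ[ℝ] 𝔸, ∀ u w, B₁ u w = G u w := by
    refine ⟨LinearMap.mk₂ ℝ G ?_ ?_ ?_ ?_, fun u w => rfl⟩
    · intro u₁ u₂ w
      simp only [hG, map_add, add_apply, add_mul, mul_add]
      abel
    · intro r u w
      simp only [hG, map_smul, smul_apply, smul_mul_assoc, mul_smul_comm, smul_add, smul_sub]
    · intro u w₁ w₂
      simp only [hG, map_add, add_apply, add_mul, mul_add]
      abel
    · intro r u w
      simp only [hG, map_smul, smul_apply, smul_mul_assoc, mul_smul_comm, smul_add, smul_sub]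
  -- the commutator part `[A_u(x), F(x)(w, v)]` is bilinear because `F(x)` is
  obtain ⟨Fb, hFb⟩ := exists_bilin_eq_curvature A (hd x).differentiableAt
  have hB₂ : ∃ B₂ : E →ₗ[ℝ] E →ₗ[ℝ] 𝔸, ∀ u w, B₂ u w = A x u * Fb w v - Fb w v * A x u := by
    refine ⟨LinearMap.mk₂ ℝ (fun u w => A x u * Fb w v - Fb w v * A x u) ?_ ?_ ?_ ?_,
      fun u w => rfl⟩
    · intro u₁ u₂ w
      simp only [map_add, add_mul, mul_add]
      abel
    · intro r u w
      simp only [map_smul, smul_mul_assoc, mul_smul_comm, smul_sub]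
    · intro u w₁ w₂
      simp only [map_add, LinearMap.add_apply, add_mul, mul_add]
      abel
    · intro r u w
      simp only [map_smul, LinearMap.smul_apply, smul_mul_assoc, mul_smul_comm, smul_sub]
  obtain ⟨B₁, hB₁⟩ := hB₁
  obtain ⟨B₂, hB₂⟩ := hB₂
  refine ⟨B₁ + B₂, fun u w => ?_⟩
  rw [LinearMap.add_apply, LinearMap.add_apply, hB₁, hB₂, hFb, covDeriv, hF' w v u, Ring.lie_def]

/-- **Frame independence of the covariant divergence.** For a `C²` connection the contraction
`∑ᵢ D_{bᵢ} (F_A(bᵢ, v))` is the same for every orthonormal frame `b`. [folklore] -/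
theorem sum_covDeriv_curvature_eq_of_orthonormalBasis {ι ι' : Type*} [Fintype ι] [Fintype ι']
    (b : OrthonormalBasis ι ℝ E) (c : OrthonormalBasis ι' ℝ E) (A : Connection E 𝔸)
    (hA : ContDiff ℝ 2 A) (x v : E) :
    ∑ i, covDeriv A (fun y => curvature A y (b i) v) x (b i) =
      ∑ j, covDeriv A (fun y => curvature A y (c j) v) x (c j) := by
  obtain ⟨B, hB⟩ := exists_bilin_eq_covDeriv_curvature A hA x v
  simp_rw [← hB]
  exact sum_apply_self_eq_of_orthonormalBasis b c B

variable [FiniteDimensional ℝ E]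

/-- The covariant divergence `div_A F_A (x)(v) = ∑ᵢ D_{bᵢ}(F_A(bᵢ, v))(x)` may be computed in any
orthonormal frame `b` (for `C²` connections; the definition uses `stdOrthonormalBasis`).
[folklore] -/
theorem divCurvature_eq_sum_orthonormalBasis {ι : Type*} [Fintype ι] (b : OrthonormalBasis ι ℝ E)
    (A : Connection E 𝔸) (hA : ContDiff ℝ 2 A) (x v : E) :
    divCurvature A x v = ∑ i, covDeriv A (fun y => curvature A y (b i) v) x (b i) :=
  sum_covDeriv_curvature_eq_of_orthonormalBasis _ b A hA x v

end FrameIndependence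

/-! ### Regularity of slices and of the joint map; periodicity -/

section SliceRegularity

variable {E : Type*} [NormedAddCommGroup E] [InnerProductSpace ℝ E]
variable {𝔸 : Type*} [NormedRing 𝔸] [NormedAlgebra ℝ 𝔸]

/-- For a `C²` connection the curvature components `y ↦ F_A(y)(u, w)` are differentiable.
[folklore] -/
theorem differentiable_curvature_apply {B : Connection E 𝔸} (hB : ContDiff ℝ 2 B) (u w : E) :
    Differentiable ℝ (fun y => curvature B y u w) := by
  have hd : Differentiable ℝ B := hB.differentiable two_ne_zero
  have hF : (fun y => curvature B y u w) =
      fun y => fderiv ℝ B y u w - fderiv ℝ B y w u + (B y u * B y w - B y w * B y u) :=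
    funext fun y => curvature_eq_of_differentiableAt B (hd y) u w
  rw [hF]
  have hd' : Differentiable ℝ (fderiv ℝ B) :=
    (hB.fderiv_right (m := 1) le_rfl).differentiable one_ne_zero
  have hc : ∀ a : E, Differentiable ℝ fun y => B y a := fun a =>
    hd.clm_apply (differentiable_const a)
  exact (((hd'.clm_apply (differentiable_const u)).clm_apply (differentiable_const w)).sub
    ((hd'.clm_apply (differentiable_const w)).clm_apply (differentiable_const u))).add
    (((hc u).mul (hc w)).sub ((hc w).mul (hc u)))

end SliceRegularity

section JointRegularity

variable {E : Type*} [NormedAddCommGroup E] [InnerProductSpace ℝ E]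
variable {𝔸 : Type*} [NormedRing 𝔸] [NormedAlgebra ℝ 𝔸]

/-- The curvature of a slice in terms of the joint derivative: for `(s, y) ∈ U`,
`F_{A(s)}(y)(u,v) = DĀ(s,y)[(0,u)] v − DĀ(s,y)[(0,v)] u + [A_u, A_v]`. [folklore] -/
theorem curvature_slice_eq {n : WithTop ℕ∞} {A : ℝ → Connection E 𝔸} {U : Set (ℝ × E)}
    (hU : IsOpen U) (hA : ContDiffOn ℝ n (fun p : ℝ × E => A p.1 p.2) U) (hn : n ≠ 0)
    {s : ℝ} {y : E} (hp : (s, y) ∈ U) (u v : E) :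
    curvature (A s) y u v =
      fderiv ℝ (fun p : ℝ × E => A p.1 p.2) (s, y) ((0 : ℝ), u) v -
        fderiv ℝ (fun p : ℝ × E => A p.1 p.2) (s, y) ((0 : ℝ), v) u + ⁅A s y u, A s y v⁆ := by
  rw [curvature, fderiv_slice_apply hU hA hn hp u v, fderiv_slice_apply hU hA hn hp v u]

/-- The curvature components `(s, y) ↦ F_{A(s)}(y)(u, v)` of a jointly `C^n` time-dependent
connection are jointly `C^m` on `U` whenever `m + 1 ≤ n`. [folklore] -/
theorem contDiffOn_curvature_joint {n m : WithTop ℕ∞} {A : ℝ → Connection E 𝔸} {U : Set (ℝ × E)}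
    (hU : IsOpen U) (hA : ContDiffOn ℝ n (fun p : ℝ × E => A p.1 p.2) U) (hmn : m + 1 ≤ n)
    (u v : E) : ContDiffOn ℝ m (fun p : ℝ × E => curvature (A p.1) p.2 u v) U := by
  set Ā := fun p : ℝ × E => A p.1 p.2 with hĀ
  have hn : n ≠ 0 := by
    rintro rfl
    exact (not_le.mpr (lt_of_lt_of_le zero_lt_one le_add_self)) hmn
  have heq : EqOn (fun p : ℝ × E => curvature (A p.1) p.2 u v)
      (fun p => fderiv ℝ Ā p ((0 : ℝ), u) v - fderiv ℝ Ā p ((0 : ℝ), v) u +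
        (Ā p u * Ā p v - Ā p v * Ā p u)) U := by
    rintro ⟨s, y⟩ hp
    simp only [curvature_slice_eq hU hA hn hp u v, Ring.lie_def, hĀ]
  refine ContDiffOn.congr ?_ heq
  have h1 : ContDiffOn ℝ m (fderiv ℝ Ā) U := hA.fderiv_of_isOpen hU hmn
  have h0 : ContDiffOn ℝ m Ā U := hA.of_le (le_trans le_self_add hmn)
  exact (((h1.clm_apply contDiffOn_const).clm_apply contDiffOn_const).sub
    ((h1.clm_apply contDiffOn_const).clm_apply contDiffOn_const)).add
    (((h0.clm_apply contDiffOn_const).mul (h0.clm_apply contDiffOn_const)).sub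
      ((h0.clm_apply contDiffOn_const).mul (h0.clm_apply contDiffOn_const)))

/-- For a `C^{k+1}` connection the curvature components `y ↦ F_A(y)(u, w)` are `C^k`.
[folklore] -/
theorem contDiff_curvature_apply {k : WithTop ℕ∞} {B : Connection E 𝔸} (hB : ContDiff ℝ (k + 1) B)
    (u w : E) : ContDiff ℝ k (fun y => curvature B y u w) := by
  have hd : Differentiable ℝ B := hB.differentiable (by simp)
  have hF : (fun y => curvature B y u w) =
      fun y => fderiv ℝ B y u w - fderiv ℝ B y w u + (B y u * B y w - B y w * B y u) :=
    funext fun y => curvature_eq_of_differentiableAt B (hd y) u w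
  rw [hF]
  have hd' : ContDiff ℝ k (fderiv ℝ B) := hB.fderiv_right le_rfl
  have h0 : ContDiff ℝ k B := hB.of_le le_self_add
  have hc : ∀ a : E, ContDiff ℝ k fun y => B y a := fun a => h0.clm_apply contDiff_const
  exact (((hd'.clm_apply contDiff_const).clm_apply contDiff_const).sub
    ((hd'.clm_apply contDiff_const).clm_apply contDiff_const)).add
    (((hc u).mul (hc w)).sub ((hc w).mul (hc u)))

/-- Partial time derivative of a map `C^n`, `n ≠ 0`, on an open subset of space-time:
`d/ds f(s, y) = Df(s,y)[(1,0)]`. [folklore] -/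
theorem hasDerivAt_curry_of_contDiffOn {F' : Type*} [NormedAddCommGroup F'] [NormedSpace ℝ F']
    {n : WithTop ℕ∞} {f : ℝ × E → F'} {U : Set (ℝ × E)} (hU : IsOpen U)
    (hf : ContDiffOn ℝ n f U) (hn : n ≠ 0) {s : ℝ} {y : E} (hp : (s, y) ∈ U) :
    HasDerivAt (fun s' => f (s', y)) (fderiv ℝ f (s, y) ((1 : ℝ), (0 : E))) s := by
  have hd : HasFDerivAt f (fderiv ℝ f (s, y)) (s, y) :=
    ((hf.differentiableOn hn).differentiableAt (hU.mem_nhds hp)).hasFDerivAt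
  have hcurve : HasDerivAt (fun s' : ℝ => ((s', y) : ℝ × E)) ((1 : ℝ), (0 : E)) s :=
    (hasDerivAt_id s).prodMk (hasDerivAt_const s y)
  have h := HasFDerivAt.comp_hasDerivAt (l := f) (f := fun s' : ℝ => ((s', y) : ℝ × E)) s hd hcurve
  simpa [Function.comp_def] using h

/-- **Periodicity passes to the joint derivative.** If every positive-time slice is invariant
under translation by `v`, then so is the joint Fréchet derivative at positive times.
[folklore] -/
theorem fderiv_joint_comp_add {A : ℝ → Connection E 𝔸} (v : E)
    (hper : ∀ s : ℝ, 0 < s → ∀ y : E, A s (y + v) = A s y) {s : ℝ} (hs : 0 < s) (y : E) :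
    fderiv ℝ (fun p : ℝ × E => A p.1 p.2) (s, y + v) =
      fderiv ℝ (fun p : ℝ × E => A p.1 p.2) (s, y) := by
  set Ā := fun p : ℝ × E => A p.1 p.2 with hĀ
  have hev : (fun p : ℝ × E => Ā (p + ((0 : ℝ), v))) =ᶠ[𝓝 (s, y)] Ā := by
    have hU : Ioi (0 : ℝ) ×ˢ (univ : Set E) ∈ 𝓝 (s, y) :=
      (isOpen_Ioi.prod isOpen_univ).mem_nhds ⟨hs, mem_univ y⟩
    filter_upwards [hU] with p hp
    obtain ⟨r, z⟩ := p
    simp only [hĀ, Prod.mk_add_mk, add_zero]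
    exact hper r hp.1 z
  rw [← hev.fderiv_eq, fderiv_comp_add_right]
  simp

/-- Periodicity of slices passes to their spatial derivatives. [folklore] -/
theorem fderiv_slice_comp_add {B : Connection E 𝔸} (v : E) (hper : ∀ y : E, B (y + v) = B y)
    (w y : E) : fderiv ℝ (fun z => B z w) (y + v) = fderiv ℝ (fun z => B z w) y := by
  rw [← fderiv_comp_add_right v]
  exact congrArg (fun g => fderiv ℝ g y) (funext fun z => by simp [hper])

/-- Periodicity of a connection passes to its curvature. [folklore] -/
theorem curvature_comp_add {B : Connection E 𝔸} (v : E) (hper : ∀ y : E, B (y + v) = B y)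
    (y u w : E) : curvature B (y + v) u w = curvature B y u w := by
  simp only [curvature, fderiv_slice_comp_add v hper, hper]

end JointRegularity

/-! ### The flat torus -/

section Torus

open scoped Matrix.Norms.Frobenius

/-- Smoothness on closed non-negative space-time `[0, ∞) × E` restricts to the open part.
[folklore] -/
theorem contDiffOn_Ioi_of_Ici {E F : Type*} [NormedAddCommGroup E] [NormedSpace ℝ E]
    [NormedAddCommGroup F] [NormedSpace ℝ F] {n : WithTop ℕ∞} {f : ℝ × E → F}
    (hf : ContDiffOn ℝ n f (Ici (0 : ℝ) ×ˢ (univ : Set E))) :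
    ContDiffOn ℝ n f (Ioi (0 : ℝ) ×ˢ (univ : Set E)) :=
  hf.mono (prod_mono Ioi_subset_Ici_self le_rfl)

/-- **Reduction of the named fact to the classical PDE statement (assembly step S5).**
`Waldron2019_yangMillsFlow_flatTorus` follows from global existence in its classical form: every
smooth `L`-periodic `𝔲(N)`-valued initial connection on `ℝ⁴` is the time-zero slice of a jointly
smooth, `L`-periodic, `𝔲(N)`-valued `A` on `[0, ∞) × ℝ⁴` satisfying `∂ₜ A_v = Σ_μ D_μ F_{μ v}`
pointwise for `t > 0` (Waldron 2019 Cor. 1.2 with Struwe's short-time existence, on the flat torus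
`ℝ⁴/Lℤ⁴`). The remaining record fields of `IsYangMillsHeatFlow` are supplied by
`IsYangMillsHeatFlow.of_contDiffOn`. [cite: Waldron2019, Cor. 1.2] -/
theorem Waldron2019_yangMillsFlow_flatTorus_of_pde
    (h : ∀ (N : ℕ) (L : ℝ), 0 < L →
      ∀ A₀ : Connection (EuclideanSpace ℝ (Fin 4)) (Matrix (Fin N) (Fin N) ℂ),
        IsSmoothConnection A₀ →
        A₀.IsValuedIn (skewAdjoint.submodule ℝ (Matrix (Fin N) (Fin N) ℂ)) →
        A₀.IsLatticePeriodic L →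
        ∃ A : ℝ → Connection (EuclideanSpace ℝ (Fin 4)) (Matrix (Fin N) (Fin N) ℂ),
          A 0 = A₀ ∧
          ContDiffOn ℝ ∞ (fun p : ℝ × EuclideanSpace ℝ (Fin 4) => A p.1 p.2) (Ici 0 ×ˢ univ) ∧
          (∀ t : ℝ, 0 ≤ t → (A t).IsLatticePeriodic L) ∧
          (∀ t : ℝ, 0 < t →
            (A t).IsValuedIn (skewAdjoint.submodule ℝ (Matrix (Fin N) (Fin N) ℂ))) ∧
          ∀ t : ℝ, 0 < t → ∀ x v : EuclideanSpace ℝ (Fin 4),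
            deriv (fun s => A s x v) t = divCurvature (A t) x v) :
    Waldron2019_yangMillsFlow_flatTorus := by
  intro N L hL A₀ hs hv hp
  obtain ⟨A, h0, hsmooth, hper, hval, hpde⟩ := h N L hL A₀ hs hv hp
  exact ⟨A, h0, hsmooth, hper,
    IsYangMillsHeatFlow.of_contDiffOn (contDiffOn_Ioi_of_Ici hsmooth) (fun t ht => hval t ht)
      fun t ht => hpde t ht⟩

/-- **`Waldron2019_yangMillsFlow_flatTorus` from its two published ingredients, with proved glue.**
Waldron's proof of Cor. 1.2 reads (p. 3): "Over a closed manifold, (1.1) is immediate from the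
global energy identity [`YangMillsHeatFlowEnergy.lean`]. Applying the short-time existence results
of Struwe, we may settle the conjecture [long-time existence]" — i.e. the named fact is the
conjunction of two analytic theorems, here taken as *hypotheses* (stated for the trivial
`U(N)`-bundle over the flat torus `ℝ⁴/Lℤ⁴`, as `L`-periodic classical solutions on `ℝ⁴`, in the
tree's conventions `∂ₜ A_v = Σ_μ D_μ F_{μ v} = −(D_A^* F_A)_v`):
* `hST` — **short-time existence of classical solutions** (Struwe 1994, the local existence theorem
  invoked by Waldron before Cor. 1.2; for smooth data also Råde 1992 / Kozono–Maeda–Naito 1995):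
  every smooth `L`-periodic `𝔲(N)`-valued `A₀` is the initial value of a solution which is jointly
  smooth on `[0, ε) × ℝ⁴` for some `ε > 0`, `L`-periodic, `𝔲(N)`-valued and solves the flow on
  `(0, ε)`;
* `hExt` — **Waldron 2019, Cor. 1.2 (first sentence): "any classical solution of (YM) extends
  smoothly for all time"**: every such classical solution on `[0, T) × ℝ⁴`, `0 < T < ∞`, is the
  restriction of a classical solution on `[0, ∞) × ℝ⁴`.
Neither hypothesis is provable over Mathlib at present (quasilinear parabolic theory; Waldron's
Thm. 1.1); the glue — restart-free, since `hExt` is Waldron's corollary as printed — and the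
passage to the flow-line record (`Waldron2019_yangMillsFlow_flatTorus_of_pde`) are proved here.
[cite: Waldron2019, Cor. 1.2 and p. 3 (proof sketch)] [cite: Struwe1994, local existence theorem] -/
theorem Waldron2019_yangMillsFlow_flatTorus_of_shortTime_of_extends
    (hST : ∀ (N : ℕ) (L : ℝ), 0 < L →
      ∀ A₀ : Connection (EuclideanSpace ℝ (Fin 4)) (Matrix (Fin N) (Fin N) ℂ),
        IsSmoothConnection A₀ →
        A₀.IsValuedIn (skewAdjoint.submodule ℝ (Matrix (Fin N) (Fin N) ℂ)) →
        A₀.IsLatticePeriodic L →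
        ∃ ε : ℝ, 0 < ε ∧
          ∃ A : ℝ → Connection (EuclideanSpace ℝ (Fin 4)) (Matrix (Fin N) (Fin N) ℂ),
            A 0 = A₀ ∧
            ContDiffOn ℝ ∞ (fun p : ℝ × EuclideanSpace ℝ (Fin 4) => A p.1 p.2)
              (Ico 0 ε ×ˢ univ) ∧
            (∀ t : ℝ, 0 ≤ t → t < ε → (A t).IsLatticePeriodic L) ∧
            (∀ t : ℝ, 0 < t → t < ε →
              (A t).IsValuedIn (skewAdjoint.submodule ℝ (Matrix (Fin N) (Fin N) ℂ))) ∧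
            ∀ t : ℝ, 0 < t → t < ε → ∀ x v : EuclideanSpace ℝ (Fin 4),
              deriv (fun s => A s x v) t = divCurvature (A t) x v)
    (hExt : ∀ (N : ℕ) (L : ℝ), 0 < L → ∀ T : ℝ, 0 < T →
      ∀ B : ℝ → Connection (EuclideanSpace ℝ (Fin 4)) (Matrix (Fin N) (Fin N) ℂ),
        ContDiffOn ℝ ∞ (fun p : ℝ × EuclideanSpace ℝ (Fin 4) => B p.1 p.2) (Ico 0 T ×ˢ univ) →
        (∀ t : ℝ, 0 ≤ t → t < T → (B t).IsLatticePeriodic L) →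
        (∀ t : ℝ, 0 < t → t < T →
          (B t).IsValuedIn (skewAdjoint.submodule ℝ (Matrix (Fin N) (Fin N) ℂ))) →
        (∀ t : ℝ, 0 < t → t < T → ∀ x v : EuclideanSpace ℝ (Fin 4),
          deriv (fun s => B s x v) t = divCurvature (B t) x v) →
        ∃ A : ℝ → Connection (EuclideanSpace ℝ (Fin 4)) (Matrix (Fin N) (Fin N) ℂ),
          (∀ t : ℝ, 0 ≤ t → t < T → A t = B t) ∧
          ContDiffOn ℝ ∞ (fun p : ℝ × EuclideanSpace ℝ (Fin 4) => A p.1 p.2) (Ici 0 ×ˢ univ) ∧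
          (∀ t : ℝ, 0 ≤ t → (A t).IsLatticePeriodic L) ∧
          (∀ t : ℝ, 0 < t →
            (A t).IsValuedIn (skewAdjoint.submodule ℝ (Matrix (Fin N) (Fin N) ℂ))) ∧
          ∀ t : ℝ, 0 < t → ∀ x v : EuclideanSpace ℝ (Fin 4),
            deriv (fun s => A s x v) t = divCurvature (A t) x v) :
    Waldron2019_yangMillsFlow_flatTorus := by
  refine Waldron2019_yangMillsFlow_flatTorus_of_pde fun N L hL A₀ hs hv hp => ?_
  obtain ⟨ε, hε, B, hB0, hBs, hBper, hBval, hBpde⟩ := hST N L hL A₀ hs hv hp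
  obtain ⟨A, hAB, hAs, hAper, hAval, hApde⟩ := hExt N L hL ε hε B hBs hBper hBval hBpde
  exact ⟨A, by rw [hAB 0 le_rfl hε, hB0], hAs, hAper, hAval, hApde⟩

end Torus

end Literature.MathematicalPhysics.QuantumLattice
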